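import Summits.QuantumFields.YangMills.Theorems.BalabanUVNodesClustersCore
import Summits.QuantumFields.YangMills.Theorems.BalabanUVNodesN20Knit
import Summits.QuantumFields.YangMills.Theorems.BalabanUVNodesN20KnitLogCut
import Summits.QuantumFields.YangMills.Theorems.BalabanUVNodesN20KnitDerived
import Literature.MathematicalPhysics.QuantumFieldTheory.Balaban1983to89.T4FiniteEpsInhabited

/-!
# YM-DAG node N20 (= NE7b) AT THE SPINE CARRIERS: the K5 stub `YMDAG.UVSplit.S_N20 SRec` of the landed cut (`BalabanUVNodesClustersCore`
# p416552) — (W2) readings, REFINEMENT-GENERIC closers over every carrier predicate `SRec` carrying a producer slot of dag-n20-a's N20 knits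
# (`N20Knit` ∕ `N20KnitThreshold` BY NAME), and the (W2) GUARDS: an INHABITED toy on which `S_N20` FIRES, the saturated-class refutation, vacuity
# over an empty predicate, and the two A2 traps located (empty bad class; negative source radius)

Track A of `YM-PLAN.md` (cell `pub-ymgap`, HUMAN RULING D-0062), node **N20**; typed by seat `pub-ymgap-dag-n27-a` (generation 4) under dag-lead's
REBALANCE №40 (the dag-n20-a base closed without successor; its knits p409854 `N20Knit`, p412199 `N20KnitThreshold`, p412464 `N20KnitLogCut`, p410322
`N20KnitDerived` are the producers consumed here BY NAME).  Shape twins: dag-n21-a's `BalabanUVNodesN21AtSpineCarriers` (+ `…Sanity`), dag-n19-a's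
`BalabanUVNodesN19AtSpineCarriers`, dag-n22-a's `BalabanUVNodesN22AtRecord`.  Kernel bookkeeping BY NAME: 0 `def`, 0 `sorry`, standard axioms.
COUNT-NEUTRAL; `--supports` the K5 item `SpineGivenEndpoint` (stmt-QuantumFields-19182).

THE STUB.  `S_N20 SRec := ∀ F D g₀ os S, SRec F D g₀ os S → T4WeightBudget.RelWeightBound S.l₀ S.T S.A S.B S.Bad S.W` — at every term-class carrier
bundle the spine-carrier predicate OF RECORD pins, the bad classes `S.Bad K t ⊆ S.T K` carry relative weight `≤ S.W K` in BOTH runs, with `0 ≤ S.W K < 1`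
and `Σ S.W < ∞` (NE7b: the persistent-activity relative weight bound; NOT PRINTED for Bałaban's d = 4 procedure — [Balaban1989LargeFieldII]
(1.79)–(1.89) pp. 383–387 display the KIND of extraction per pinned old genealogy; the summable COUNT is the cell's).

WHAT THIS MODULE IS.
* §1 (W2) READINGS: `s_N20_iff` (`Iff.rfl`); the node's consumer faces at the record (`relWeightBound_at_record`, `weight_lt_one_at_record`,
  `summable_weight_at_record`, `badWeight_le_at_record_left ∕ _right`).  Antitonicity in `SRec` is `…N27SpineRecord.s_N20_antitone` (module
  `BalabanUVNodesN27AtRecord`, p418134) and the exact-carriers extraction-laws reading is `…N27SpineRecord.s_N20_of_extractionLawsReading`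
  (`BalabanUVNodesN27AtRecordReadings`, p419605) — CITED, not restated.
* §2 (W2) CLOSERS, refinement-generic over every `SRec` carrying the slot: `s_N20_of_relWeightBoundSlot` (the record's `S.W` is a pinned majorant of a
  producer's weight — `N20Knit.relWeightBound_mono_weight`), `s_N20_of_extractionLawsMajorantReading` (two runs' `PinnedExtraction.ExtractionLaws` + the
  count under the two-rate majorant `S.W K = V·r^{K − j⋆ K}` — `N20Knit.relWeightBound_of_extractionLaws_majorant`), `s_N20_of_thresholdReading` (the
  bundle's carriers ARE the `K₁`-shifted families beyond the numeric threshold `V·r^{K₁ − jhalf K₁} < 1` — `N20KnitThreshold.relWeightBound_of_extractionLaws_threshold`),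
  `s_N20_of_logCutReading` (the same at the LOG cut `jlogOf C`, SREC5 interface I-3 — `N20KnitLogCut.relWeightBound_of_extractionLaws_threshold_log`).
* §3 (W2) GUARDS: `s_N20_fires_on_toy` (INHABITED: an `SRec` over SU(2) data pinning dag-n20-a's two-term bundle — bad class `{false}` NONEMPTY at every
  cutoff, `S.W K = (1∕2)^{K+1}`, `S.l₀ = 1` — is inhabited at some `(F, D, g₀, os, S)` and `S_N20` FIRES on it by `N20KnitDerived.relWeightBound_toy`);
  `not_s_N20_of_admits` (R422 at node level); `not_s_N20_of_admits_saturated` (an `SRec` admitting a bundle whose run A is the SATURATED toy — bad weight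
  not decaying — has NO `S_N20`, whatever its weight slot: `N20KnitDerived.not_exists_relWeightBound_toy_saturated`); `s_N20_of_empty`; A2 TRAPS LOCATED:
  `s_N20_of_noBadReading` (`S.Bad = ∅`, `S.W = 0` ⇒ `S_N20` free) and `s_N20_of_negRadiusReading` (`S.l₀ < 0` ⇒ free, `N20KnitDerived.relWeightBound_of_radius_neg`)
  ⇒ READING FOR THE `SRec` AUTHOR (NODE 00 ₉ ∕ rev 1): pin `S.Bad` = the budget's own saturated bad set (the SAME classes N19's cores exclude) and `0 < S.l₀`
  (carried by `S_N27x`).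

HONEST FRAMING.  NE7b is NOT PRINTED and NOT PROVED.  `S_N20 SRec` quantifies over the carriers OF RECORD that `SRec` pins (NODE 00 ∕ NODE O — no such
predicate exists in the tree); this file says what a record predicate must supply for N20 to follow from the tree's constructors, and shows the slot is
neither void nor free.  Every extraction law, count and majorant is a HYPOTHESIS; nothing of Bałaban's is asserted or instantiated; N20 is NOT discharged
(0∕1 at every record); typed 28∕28, discharged count untouched; one finite four-torus programme at fixed `ε` — NOT ℝ⁴, NOT infinite volume, NOT OS, NOT a
mass gap, NOT Clay.  Restate-immune (neither the Theses file nor any ∃-currency module imported).  No decl below carries a cite tag.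
-/

open Finset

namespace Summit.QuantumFields.YangMills.Theorems.N20AtSpineCarriers

open Literature.MathematicalPhysics.QuantumFieldTheory.Balaban1983to89
open Literature.MathematicalPhysics.QuantumFieldTheory.Balaban1983to89.T4Continuum
open T4WeightBudget (RelWeightBound)
open T4RenewalChains (jhalf)
open Summit.QuantumFields.BalabanUV.T4Continuum.NE7b.PinnedExtraction (ExtractionLaws)
open Summit.QuantumFields.YangMills.BalabanUVNodes.N20Knit (relWeightBound_of_extractionLaws_majorant relWeightBound_mono_weight)
open Summit.QuantumFields.YangMills.BalabanUVNodes.N20KnitThreshold (relWeightBound_of_extractionLaws_threshold)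
open Summit.QuantumFields.YangMills.BalabanUVNodes.N20KnitLogCut (relWeightBound_of_extractionLaws_threshold_log)
open T4GoodClassBudget (jlogOf)
open Summit.QuantumFields.YangMills.BalabanUVNodes.N20KnitDerived (relWeightBound_toy not_exists_relWeightBound_toy_saturated
  relWeightBound_of_radius_neg)
open YMDAG.UVSplit (Datum SpineCarriers SpineRecordPred S_N20)

variable {N : ℕ} [NeZero N]

/-! ## §1 (W2) readings: the stub unfolded and the node's consumer faces at the record -/

/-- **What `S_N20 SRec` says** (`Iff.rfl`): at every bundle the spine-carrier predicate pins, NE7b's `RelWeightBound` at the bundle's own radius,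
classes, two runs' weights, bad classes and weight slot. [bookkeeping] -/
theorem s_N20_iff (SRec : SpineRecordPred N) :
    S_N20 SRec ↔ ∀ (F : T4Family) (D : Datum F N) (g₀ : ℕ → ℝ) (os : List (ULoop F)) (S : SpineCarriers),
      SRec F D g₀ os S → RelWeightBound S.l₀ S.T S.A S.B S.Bad S.W :=
  Iff.rfl

section AtRecord

variable {SRec : SpineRecordPred N} {F : T4Family} {D : Datum F N} {g₀ : ℕ → ℝ} {os : List (ULoop F)} {S : SpineCarriers}

/-- NE7b at a bundle of record. [bookkeeping] -/
theorem relWeightBound_at_record (h : S_N20 SRec) (hS : SRec F D g₀ os S) : RelWeightBound S.l₀ S.T S.A S.B S.Bad S.W :=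
  h F D g₀ os S hS

/-- `S.W K < 1` at a bundle of record (so `−log (1 − W K)` is finite). [bookkeeping] -/
theorem weight_lt_one_at_record (h : S_N20 SRec) (hS : SRec F D g₀ os S) (K : ℕ) : S.W K < 1 :=
  (h F D g₀ os S hS).lt_one K

/-- `Σ_K S.W K < ∞` at a bundle of record (the summable count). [bookkeeping] -/
theorem summable_weight_at_record (h : S_N20 SRec) (hS : SRec F D g₀ os S) : Summable S.W :=
  (h F D g₀ os S hS).summable

/-- Run A: the bad class carries at most the fraction `S.W K` of the total, `|t| ≤ S.l₀`. [bookkeeping] -/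
theorem badWeight_le_at_record_left (h : S_N20 SRec) (hS : SRec F D g₀ os S) (K : ℕ) (t : ℝ) (ht : |t| ≤ S.l₀) :
    ∑ τ ∈ S.Bad K t, S.A K t τ ≤ S.W K * ∑ τ ∈ S.T K, S.A K t τ :=
  (h F D g₀ os S hS).bad_left K t ht

/-- Run B: likewise. [bookkeeping] -/
theorem badWeight_le_at_record_right (h : S_N20 SRec) (hS : SRec F D g₀ os S) (K : ℕ) (t : ℝ) (ht : |t| ≤ S.l₀) :
    ∑ τ ∈ S.Bad K t, S.B K t τ ≤ S.W K * ∑ τ ∈ S.T K, S.B K t τ :=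
  (h F D g₀ os S hS).bad_right K t ht

end AtRecord

/-! ## §2 (W2) closers, refinement-generic over every carrier predicate carrying a producer slot -/

/-- **`S_N20` FOR EVERY WEIGHT-SLOT READING.**  If `SRec` hands, with every bundle `S` it pins, a `RelWeightBound` at `S`'s own carriers with SOME
producer weight `W′` dominated by the record's slot (`W′ K ≤ S.W K`), the slot itself `< 1` and summable, and termwise nonnegative weights on the classes
— then `S_N20 SRec` (`N20Knit.relWeightBound_mono_weight` BY NAME: the record's `S.W` is a pinned majorant of what a witness road delivers). [bookkeeping] -/
theorem s_N20_of_relWeightBoundSlot (SRec : SpineRecordPred N)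
    (hread : ∀ (F : T4Family) (D : Datum F N) (g₀ : ℕ → ℝ) (os : List (ULoop F)) (S : SpineCarriers), SRec F D g₀ os S →
      ∃ W' : ℕ → ℝ, RelWeightBound S.l₀ S.T S.A S.B S.Bad W' ∧ (∀ K, W' K ≤ S.W K) ∧ (∀ K, S.W K < 1) ∧ Summable S.W ∧
        (∀ (K : ℕ) (t : ℝ), |t| ≤ S.l₀ → ∀ τ ∈ S.T K, 0 ≤ S.A K t τ) ∧ (∀ (K : ℕ) (t : ℝ), |t| ≤ S.l₀ → ∀ τ ∈ S.T K, 0 ≤ S.B K t τ)) :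
    S_N20 SRec := by
  intro F D g₀ os S hS
  obtain ⟨W', hW', hle, h1, hs, hA, hB⟩ := hread F D g₀ os S hS
  exact relWeightBound_mono_weight hW' hle h1 hs hA hB

/-- **`S_N20` FOR EVERY EXTRACTION-LAWS READING UNDER THE TWO-RATE MAJORANT.**  If `SRec` hands, with every bundle, the two runs'
`PinnedExtraction.ExtractionLaws` over `S.T`, `S.Bad` (pinned classes, sub-classes, source-uniform quotients — the H3^NE7b display), nonnegative weights, and
the cell's COUNT in two-rate currency — quotient totals `≤ V·r^{K − j⋆(K)}` in both runs, `0 < r < 1`, `0 ≤ V`, a positive fraction `c·K ≤ K − j⋆(K)` of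
old steps, `V·r^{K − j⋆(K)} < 1` at every `K` — with the record's slot `S.W = (K ↦ V·r^{K − j⋆(K)})`, then `S_N20 SRec`
(`N20Knit.relWeightBound_of_extractionLaws_majorant` BY NAME). [bookkeeping] -/
theorem s_N20_of_extractionLawsMajorantReading (SRec : SpineRecordPred N)
    (hread : ∀ (F : T4Family) (D : Datum F N) (g₀ : ℕ → ℝ) (os : List (ULoop F)) (S : SpineCarriers), SRec F D g₀ os S →
      ∃ (α α' : Type) (X : ℕ → Finset α) (Badx : ℕ → α → Finset S.ι) (q : ℕ → α → ℝ)
        (X' : ℕ → Finset α') (Badx' : ℕ → α' → Finset S.ι) (q' : ℕ → α' → ℝ) (r V c : ℝ) (jstar : ℕ → ℕ),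
        ExtractionLaws S.l₀ S.T S.A S.Bad X Badx q ∧ ExtractionLaws S.l₀ S.T S.B S.Bad X' Badx' q' ∧
        (∀ (K : ℕ) (t : ℝ), |t| ≤ S.l₀ → ∀ τ, 0 ≤ S.A K t τ) ∧ (∀ (K : ℕ) (t : ℝ), |t| ≤ S.l₀ → ∀ τ, 0 ≤ S.B K t τ) ∧
        0 < r ∧ r < 1 ∧ 0 ≤ V ∧ 0 < c ∧ (∀ K : ℕ, c * K ≤ ((K - jstar K : ℕ) : ℝ)) ∧
        (∀ K, ∑ x ∈ X K, q K x ≤ V * r ^ (K - jstar K)) ∧ (∀ K, ∑ x ∈ X' K, q' K x ≤ V * r ^ (K - jstar K)) ∧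
        (∀ K, V * r ^ (K - jstar K) < 1) ∧ S.W = fun K => V * r ^ (K - jstar K)) :
    S_N20 SRec := by
  intro F D g₀ os S hS
  obtain ⟨α, α', X, Badx, q, X', Badx', q', r, V, c, jstar, hA, hB, hA0, hB0, h0, hr1, hV, hc, hfrac, hmajA, hmajB, hlt, hW⟩ :=
    hread F D g₀ os S hS
  rw [hW]
  exact relWeightBound_of_extractionLaws_majorant hA hB hA0 hB0 h0 hr1 hV hc hfrac hmajA hmajB hlt

/-- **`S_N20` FOR EVERY THRESHOLD READING (shifted exact carriers).**  If `SRec` pins, with every bundle, carriers that ARE the `K₁`-SHIFTED families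
of some unshifted data `(T₀, A₀, B₀, Bad₀)` — `S.T = (K ↦ T₀ (K₁ + K))` etc., slot `S.W = (K ↦ V·r^{(K₁+K) − jhalf (K₁+K)})` — together with the two runs'
extraction laws over `(T₀, Bad′)`, nonnegative weights, the count from `K₁` on (`≤ V·r^{K − jhalf K}`), `Bad′ = Bad₀` from `K₁` on, `0 < r < 1`, `0 ≤ V`, and
the NUMERIC side condition `V·r^{K₁ − jhalf K₁} < 1`, then `S_N20 SRec` (`N20KnitThreshold.relWeightBound_of_extractionLaws_threshold` BY NAME — the currency
of N20's producers «from some origin on»; the offset is free in `SpineDatum`). [bookkeeping] -/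
theorem s_N20_of_thresholdReading (SRec : SpineRecordPred N)
    (hread : ∀ (F : T4Family) (D : Datum F N) (g₀ : ℕ → ℝ) (os : List (ULoop F)) (S : SpineCarriers), SRec F D g₀ os S →
      ∃ (T₀ : ℕ → Finset S.ι) (A₀ B₀ : ℕ → ℝ → S.ι → ℝ) (Bad₀ Bad' : ℕ → ℝ → Finset S.ι) (α α' : Type)
        (X : ℕ → Finset α) (Badx : ℕ → α → Finset S.ι) (q : ℕ → α → ℝ)
        (X' : ℕ → Finset α') (Badx' : ℕ → α' → Finset S.ι) (q' : ℕ → α' → ℝ) (r V : ℝ) (K₁ : ℕ),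
        S.T = (fun K => T₀ (K₁ + K)) ∧ S.A = (fun K => A₀ (K₁ + K)) ∧ S.B = (fun K => B₀ (K₁ + K)) ∧
        S.Bad = (fun K => Bad₀ (K₁ + K)) ∧ S.W = (fun K => V * r ^ (K₁ + K - jhalf (K₁ + K))) ∧
        ExtractionLaws S.l₀ T₀ A₀ Bad' X Badx q ∧ ExtractionLaws S.l₀ T₀ B₀ Bad' X' Badx' q' ∧
        (∀ (K : ℕ) (t : ℝ), |t| ≤ S.l₀ → ∀ τ, 0 ≤ A₀ K t τ) ∧ (∀ (K : ℕ) (t : ℝ), |t| ≤ S.l₀ → ∀ τ, 0 ≤ B₀ K t τ) ∧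
        0 < r ∧ r < 1 ∧ 0 ≤ V ∧
        (∀ K, K₁ ≤ K → ∑ x ∈ X K, q K x ≤ V * r ^ (K - jhalf K)) ∧ (∀ K, K₁ ≤ K → ∑ x ∈ X' K, q' K x ≤ V * r ^ (K - jhalf K)) ∧
        (∀ (K : ℕ) (t : ℝ), K₁ ≤ K → Bad' K t = Bad₀ K t) ∧ V * r ^ (K₁ - jhalf K₁) < 1) :
    S_N20 SRec := by
  intro F D g₀ os S hS
  obtain ⟨T₀, A₀, B₀, Bad₀, Bad', α, α', X, Badx, q, X', Badx', q', r, V, K₁, hT, hA, hB, hBad, hW, hxA, hxB, hA0, hB0, h0, hr1, hV,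
    hmajA, hmajB, hBB, hthr⟩ := hread F D g₀ os S hS
  rw [hT, hA, hB, hBad, hW]
  exact relWeightBound_of_extractionLaws_threshold hxA hxB hA0 hB0 h0 hr1 hV hmajA hmajB hBB hthr

/-- **`S_N20` FOR EVERY LOG-CUT THRESHOLD READING** (interface I-3 of the SREC5 design (C)(iii), pub-ymgap INBOX l.9220: the bad class pinned at the
logarithmic window `jlog(K) = K − ⌈C·log(K+1)⌉`, ONE cut for both budgets).  As `s_N20_of_thresholdReading` with the count in LOG-CUT currency
(`≤ V·r^{K − jlogOf C K}` from `K₁` on, `C·(−log r) > 1`), slot `S.W = (K ↦ V·r^{(K₁+K) − jlogOf C (K₁+K)})` and side condition `V·r^{K₁ − jlogOf C K₁} < 1`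
(`N20KnitLogCut.relWeightBound_of_extractionLaws_threshold_log` BY NAME). [bookkeeping] -/
theorem s_N20_of_logCutReading (SRec : SpineRecordPred N)
    (hread : ∀ (F : T4Family) (D : Datum F N) (g₀ : ℕ → ℝ) (os : List (ULoop F)) (S : SpineCarriers), SRec F D g₀ os S →
      ∃ (T₀ : ℕ → Finset S.ι) (A₀ B₀ : ℕ → ℝ → S.ι → ℝ) (Bad₀ Bad' : ℕ → ℝ → Finset S.ι) (α α' : Type)
        (X : ℕ → Finset α) (Badx : ℕ → α → Finset S.ι) (q : ℕ → α → ℝ)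
        (X' : ℕ → Finset α') (Badx' : ℕ → α' → Finset S.ι) (q' : ℕ → α' → ℝ) (r V C : ℝ) (K₁ : ℕ),
        S.T = (fun K => T₀ (K₁ + K)) ∧ S.A = (fun K => A₀ (K₁ + K)) ∧ S.B = (fun K => B₀ (K₁ + K)) ∧
        S.Bad = (fun K => Bad₀ (K₁ + K)) ∧ S.W = (fun K => V * r ^ (K₁ + K - jlogOf C (K₁ + K))) ∧
        ExtractionLaws S.l₀ T₀ A₀ Bad' X Badx q ∧ ExtractionLaws S.l₀ T₀ B₀ Bad' X' Badx' q' ∧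
        (∀ (K : ℕ) (t : ℝ), |t| ≤ S.l₀ → ∀ τ, 0 ≤ A₀ K t τ) ∧ (∀ (K : ℕ) (t : ℝ), |t| ≤ S.l₀ → ∀ τ, 0 ≤ B₀ K t τ) ∧
        0 < r ∧ r < 1 ∧ 0 ≤ V ∧ 1 < C * (-Real.log r) ∧
        (∀ K, K₁ ≤ K → ∑ x ∈ X K, q K x ≤ V * r ^ (K - jlogOf C K)) ∧
        (∀ K, K₁ ≤ K → ∑ x ∈ X' K, q' K x ≤ V * r ^ (K - jlogOf C K)) ∧
        (∀ (K : ℕ) (t : ℝ), K₁ ≤ K → Bad' K t = Bad₀ K t) ∧ V * r ^ (K₁ - jlogOf C K₁) < 1) :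
    S_N20 SRec := by
  intro F D g₀ os S hS
  obtain ⟨T₀, A₀, B₀, Bad₀, Bad', α, α', X, Badx, q, X', Badx', q', r, V, C, K₁, hT, hA, hB, hBad, hW, hxA, hxB, hA0, hB0, h0, hr1, hV, hC,
    hmajA, hmajB, hBB, hthr⟩ := hread F D g₀ os S hS
  rw [hT, hA, hB, hBad, hW]
  exact relWeightBound_of_extractionLaws_threshold_log hxA hxB hA0 hB0 h0 hr1 hV hC hmajA hmajB hBB hthr

/-! ## §3 (W2) guards: INHABITED and firing; the slot decides; vacuity over an empty predicate; two A2 traps located -/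

/-- **INHABITED AND FIRING.**  There are a carrier bundle `S₀` and a carrier predicate `SRec` over `SU(2)` data such that: `SRec` pins exactly `S₀`
(at every datum, bare sequence and string); it is INHABITED — some four-torus family, datum, bare sequence and string carry `S₀`
(`T4FiniteEpsInhabited.nonempty_finiteEpsData_SU`); `S₀` is NON-DEGENERATE — bad class `{false}` nonempty at every cutoff and source, positive radius
`l₀ = 1`, positive slot `S₀.W K = (1∕2)^{K+1}`; and `S_N20 SRec` HOLDS, by dag-n20-a's `N20KnitDerived.relWeightBound_toy` (two terms: `true` of weight `1`,
`false` of weight `(1∕2)^{K+1}`, both runs).  So the K5 slot is not void and the closers are not the empty implication. [bookkeeping] -/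
theorem s_N20_fires_on_toy :
    ∃ (S₀ : SpineCarriers) (SRec : SpineRecordPred 2),
      (∀ (F : T4Family) (D : Datum F 2) (g₀ : ℕ → ℝ) (os : List (ULoop F)) (S : SpineCarriers), SRec F D g₀ os S ↔ S = S₀) ∧
      (∃ (F : T4Family) (D : Datum F 2) (g₀ : ℕ → ℝ) (os : List (ULoop F)), SRec F D g₀ os S₀) ∧
      (∀ (K : ℕ) (t : ℝ), (S₀.Bad K t).Nonempty) ∧ 0 < S₀.l₀ ∧ (∀ K, 0 < S₀.W K) ∧
      S_N20 SRec := by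
  let S₀ : SpineCarriers :=
    { ι := Bool, l₀ := 1, vol := 1, K₀ := 0, T := fun _ => Finset.univ,
      A := fun K _ b => if b then (1 : ℝ) else (1 / 2 : ℝ) ^ (K + 1),
      B := fun K _ b => if b then (1 : ℝ) else (1 / 2 : ℝ) ^ (K + 1),
      shA := fun _ _ _ => 0, shB := fun _ _ _ => 0, Bad := fun _ _ => {false},
      W := fun K => (1 / 2 : ℝ) ^ (K + 1), Wsh := fun _ => 0, δ := fun _ => 0 }
  obtain ⟨D⟩ := T4FiniteEpsInhabited.nonempty_finiteEpsData_SU (⟨13, ⟨⟨6, rfl⟩, by norm_num⟩, by norm_num, 1, le_rfl⟩ : T4Family) 2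
  refine ⟨S₀, fun _ _ _ _ S => S = S₀, fun _ _ _ _ _ => Iff.rfl, ⟨_, D, fun _ => 1, [], rfl⟩,
    fun _ _ => Finset.singleton_nonempty _, one_pos, fun K => by positivity, ?_⟩
  intro F D' g₀ os S hS
  subst hS
  exact relWeightBound_toy

/-- **R422 AT NODE LEVEL**: a carrier predicate admitting one bundle WITHOUT `RelWeightBound` at its carriers has no `S_N20`. [bookkeeping] -/
theorem not_s_N20_of_admits (SRec : SpineRecordPred N)
    (h : ∃ (F : T4Family) (D : Datum F N) (g₀ : ℕ → ℝ) (os : List (ULoop F)) (S : SpineCarriers),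
      SRec F D g₀ os S ∧ ¬ RelWeightBound S.l₀ S.T S.A S.B S.Bad S.W) :
    ¬ S_N20 SRec := by
  rintro hS
  obtain ⟨F, D, g₀, os, S, hR, hn⟩ := h
  exact hn (hS F D g₀ os S hR)

/-- **THE SLOT DECIDES — SATURATED CLASSES REFUTE `S_N20`.**  A carrier predicate admitting a bundle whose run A is dag-n20-a's SATURATED two-term family
(both terms of weight `1`, bad class `{false}` = half the total at EVERY cutoff, radius `1`) has NO `S_N20` — whatever its run B, shells, slot `W`, volume
letter, offset and remainder (`N20KnitDerived.not_exists_relWeightBound_toy_saturated` BY NAME: no weight sequence bounds a non-decaying bad class summably).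
N20's content is the summable DECAY of the old classes' relative weight. [bookkeeping] -/
theorem not_s_N20_of_admits_saturated (SRec : SpineRecordPred N) (B : ℕ → ℝ → Bool → ℝ) (shA shB : ℕ → ℝ → Bool → ℝ)
    (W Wsh δ : ℕ → ℝ) (vol : ℝ) (K₀ : ℕ)
    (h : ∃ (F : T4Family) (D : Datum F N) (g₀ : ℕ → ℝ) (os : List (ULoop F)),
      SRec F D g₀ os
        { ι := Bool, l₀ := 1, vol := vol, K₀ := K₀, T := fun _ => Finset.univ, A := fun _ _ _ => (1 : ℝ), B := B,
          shA := shA, shB := shB, Bad := fun _ _ => {false}, W := W, Wsh := Wsh, δ := δ }) :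
    ¬ S_N20 SRec := by
  rintro hS
  obtain ⟨F, D, g₀, os, hR⟩ := h
  exact not_exists_relWeightBound_toy_saturated B ⟨W, hS F D g₀ os _ hR⟩

/-- **VACUITY over an empty predicate**: an `SRec` pinning no bundle at all has `S_N20` for free — which is why the INHABITED rider and K5's existence
stub `S_N27x` matter. [bookkeeping] -/
theorem s_N20_of_empty (SRec : SpineRecordPred N)
    (h : ∀ (F : T4Family) (D : Datum F N) (g₀ : ℕ → ℝ) (os : List (ULoop F)) (S : SpineCarriers), ¬ SRec F D g₀ os S) :
    S_N20 SRec :=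
  fun F D g₀ os S hS => absurd hS (h F D g₀ os S)

/-- **A2 TRAP 1, LOCATED — THE EMPTY BAD CLASS IS FREE.**  A carrier predicate pinning bundles with NO bad class (`S.Bad K t = ∅`) and zero slot
(`S.W = 0`) has `S_N20` with no estimate at all, for ANY two runs' weights.  So the stub's text does not protect it against this junk: what protects the
join is that the SAME `S.Bad` is the set N19's `Spine.NE7.Core` EXCLUDES (the core sandwich on `S.T K ∖ S.Bad K t` must then hold for every term) —
reading for the `SRec` author: pin `S.Bad` to the budget's own saturated bad set, once, for N19 and N20 together. [bookkeeping] -/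
theorem s_N20_of_noBadReading (SRec : SpineRecordPred N)
    (hread : ∀ (F : T4Family) (D : Datum F N) (g₀ : ℕ → ℝ) (os : List (ULoop F)) (S : SpineCarriers), SRec F D g₀ os S →
      (∀ (K : ℕ) (t : ℝ), S.Bad K t = ∅) ∧ (∀ K, S.W K = 0)) :
    S_N20 SRec := by
  intro F D g₀ os S hS
  obtain ⟨hBad, hW⟩ := hread F D g₀ os S hS
  exact
    { bad_subset := fun K t _ => by rw [hBad K t]; exact Finset.empty_subset _
      nonneg := fun K => (hW K).symm.le
      lt_one := fun K => by rw [hW K]; exact zero_lt_one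
      summable := (summable_congr hW).2 summable_zero
      bad_left := fun K t _ => by rw [hBad K t, Finset.sum_empty, hW K, zero_mul]
      bad_right := fun K t _ => by rw [hBad K t, Finset.sum_empty, hW K, zero_mul] }

/-- **A2 TRAP 2, LOCATED — A NEGATIVE SOURCE RADIUS IS FREE.**  A carrier predicate pinning bundles with `S.l₀ < 0` (no source `t` has `|t| ≤ S.l₀`)
and any slot with `0 ≤ S.W K < 1`, `Σ S.W < ∞` has `S_N20` for ANY classes and weights (`N20KnitDerived.relWeightBound_of_radius_neg` BY NAME) — reading
for the `SRec` author: `0 < S.l₀` must be pinned (K5's `S_N27x` carries it; `SpineDatum` carries `0 < l₀` as a conjunct). [bookkeeping] -/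
theorem s_N20_of_negRadiusReading (SRec : SpineRecordPred N)
    (hread : ∀ (F : T4Family) (D : Datum F N) (g₀ : ℕ → ℝ) (os : List (ULoop F)) (S : SpineCarriers), SRec F D g₀ os S →
      S.l₀ < 0 ∧ (∀ K, 0 ≤ S.W K) ∧ (∀ K, S.W K < 1) ∧ Summable S.W) :
    S_N20 SRec := by
  intro F D g₀ os S hS
  obtain ⟨hl, h0, h1, hs⟩ := hread F D g₀ os S hS
  exact relWeightBound_of_radius_neg hl S.T S.A S.B S.Bad h0 h1 hs

end Summit.QuantumFields.YangMills.Theorems.N20AtSpineCarriers
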